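import Literature.Algebra.EuclideanLattices.GaussianNoiseOneDim
import Literature.Algebra.EuclideanLattices.DiscreteGaussianCosets
import Mathlib.Probability.Distributions.Uniform
import HarnessLib

/-!
# BLPRS 2013, Lemma 3.5 with `G = I`: the Gaussian-rounding core of modulus switching (lattice form)

Topic `Algebra/EuclideanLattices` (family `pqc`). Layer L1 of the decomposition of the named fact
`Literature.Computability.Cryptography.blprs_gapSVP_sqrt_dim_to_lwe_classical` (**pqc.S21**;
Brakerski–Langlois–Peikert–Regev–Stehlé, *Classical hardness of learning with errors*, STOC 2013):
its assembly `blprs_gapSVP_sqrt_dim_to_lwe_classical_of_components` (`Cryptography/BLPRSReduction.lean`)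
takes as third component the modulus-switching reduction of BLPRS §3 (Cor. 3.2 = Thm. 3.1 with `G = I`),
and "Theorem 3.1 follows immediately from Lemma 3.5" (p. 12). This file PROVES the mathematical
content of **Lemma 3.5 for `G = I`** (`n' = n`, `Λ = q'⁻¹ℤⁿ ⊇ ℤⁿ`), in coordinate-free form, from the
L0 toolkit already in the tree (BLPRS Lemma 2.7 = `GaussianCosetSmoothing.lean`, Lemma 2.9 = Regev's
Cor. 3.10 = `GaussianNoiseOneDim.lean`, MR07 Lemma 2.9 = `SmoothingParameterSuccMin.lean`). Everything
is a `theorem` (no named fact, no `sorry`); the new `def`s are the laws being compared.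

## The lemma (as printed, arXiv:1306.0281 pp. 11–12) and its lattice form

Lemma 3.5 (`G = I`): let `q, q' ≥ 1`, `Λ = q'⁻¹ℤⁿ` (basis `I/q'`), `ε ∈ (0, 1/2)`,
`r ≥ max(q⁻¹, q'⁻¹) · √(2 ln(2n(1+1/ε))/π)`, `B ≥ 0`. The map `𝕋_qⁿ × 𝕋 → 𝕋_{q'}ⁿ × 𝕋`: on `(a, b)`,
choose `f ← D_{Λ - a, r}`, let `v = a + f ∈ Λ/ℤⁿ` (= `a'`), choose `e' ← D_{rB}`, output
`(a', b + e')`. Properties: (i) a uniform input is mapped to within statistical distance `4ε` of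
uniform; (ii) an input from `A_{q,s,D_α}`, `s ∈ ℤⁿ`, `‖s‖ ≤ B`, is mapped to within `10ε` of
`A_{q',s,D_{α'}}`, `α'² = α² + r²(‖s‖² + B²)`.

Lattice form used here: `E` a Euclidean space, `M ≤ Λ₁`, `M ≤ Λ₂` lattices (`M = ℤⁿ`, `Λ₁ = q⁻¹ℤⁿ`,
`Λ₂ = q'⁻¹ℤⁿ`), with systems of representatives `(t₁, cl₁)` of `Λ₁/M` (indexed by a finite type
`ι₁` = `ℤ_qⁿ`) and `(t₂, cl₂)` of `Λ₂/M` (`ι₂` = `ℤ_{q'}ⁿ`) (`IsCosetReps`). The input `a` is uniform on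
`ι₁` with representative `ā = t₁ a`; `f ← D_{Λ₂ - ā, r}` means `x = ā + f ← D_{Λ₂, r, ā}` (the tree's
`discreteGaussian Λ₂ r (t₁ a)`), and `a' = v = cl₂ x`. Writing the input sample as `b = ⟨ā, s⟩ + e`,
`e ← D_α`, the output is `b' = ⟨x, s⟩ + w` with **`w = e + ⟨-f, s⟩ + e'`**, `-f = ā - x`, and
`⟨x, s⟩ ≡ ⟨t₂ v, s⟩ (mod 1)` whenever `⟨M, s⟩ ⊆ ℤ`; so the output pair is a fixed measurable function of
`(v, w)`, and `A_{q',s,D_{α'}}` is the same function of (uniform `v`, independent `w ← D_{α'}`). Hence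
property (ii) is the statement that the joint law of `(v, w)` (`jointLaw`) is close to
uniform ⊗ `D_{α'}` (`targetLaw`), and the discrete core of (i) is that the law of `v` (`fstLaw`) is
close to uniform (the second output coordinate `b + e'` is uniform and independent of `v` when `b` is).
The printed hypothesis on `r` enters only through `η_ε(Λ₁) ≤ r/√2` and `η_ε(Λ₂) ≤ r` (BLPRS Lemma 2.5
with `‖B̃‖ = q⁻¹, q'⁻¹`), which are the hypotheses here.

## Results

* `IsCosetReps M Λ t cl`, `IsCosetReps.repEquiv : ι × M ≃ Λ` (`(a, m) ↦ t a - m`),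
  `IsCosetReps.classEquiv i : M ≃ {y ∈ Λ | cl y = i}`; `tsum_ite_cl_eq_tsum` — the reindexing
  "sum over all `ā, f̄` with `ā + f̄ = v̄`" = a sum over `Λ₁`.
* `coreSum`, `cosetSum`, and the two-sided comparison `inv_mul_mul_cosetSum_le_coreSum`,
  `ofReal_mul_coreSum_le` (eq. (3.1) of the proof: each mixing Gaussian has normaliser
  `ρ_{r,ā}(Λ₂) ∈ [(1-ε)/(1+ε), 1] ρ_r(Λ₂)`, and `ρ_{r,t₂ i}(Λ₁) ∈ [(1-ε)/(1+ε), 1] ρ_r(Λ₁)`), the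
  normalisation `sum_coreSum_one`, and the KEY LOWER BOUND `sq_mul_inv_card_mul_cosetSum_le`:
  `((1-ε)/(1+ε))² N₂⁻¹ Q(g, i) ≤ N₁⁻¹ S(g, i)` for every weight `g` on the offset `-f`.
* **Lemma 3.5 (i), discrete core**: `fstLaw`, `sq_mul_inv_card_le_fstLaw` (every class has probability
  `≥ ((1-ε)/(1+ε))²/N₂`), `abs_sum_fstLaw_toReal_sub_le` (**`|Pr[v ∈ S] - |S|/N₂| ≤ 4ε`**), via
  `abs_sum_sub_card_div_le` (Claim 2.1 on a finite set) and `one_sub_sq_ratio_le`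
  (`1 - ((1-ε)/(1+ε))² ≤ 4ε`).
* **Lemma 3.5 (ii)**: `noiseLaw` (`D_γ`, `γ² = α² + (rB)²`, the law of `e + e'`), `jointLaw`, `targetLaw`,
  `abs_cosetSum_noise_toReal_sub_le` (the noise step: Regev's Cor. 3.10 applied ONCE to `⟨-f, s⟩ + (e + e')`
  — its hypothesis `η_ε(Λ₁) ≤ 1/√(1/r² + (‖s‖/γ)²)` follows from `‖s‖/γ ≤ B/(rB) = 1/r` and
  `η_ε(Λ₁) ≤ r/√2`), `sq_div_card_mul_sub_le_jointLaw_toReal`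
  (`Pr[(v,w) ∈ {i} × B'] ≥ ((1-ε)/(1+ε))²/N₂ · (D_{α'}(B') - 4ε)`), and the conclusion
  **`abs_jointLaw_real_sub_targetLaw_real_le`: `|Pr_joint[A] - Pr_target[A]| ≤ 8ε`** for every
  measurable `A`, packaged as the printed **`statDist_jointLaw_targetLaw_le : Δ ≤ 10ε`**.

## Proof (as printed, with one simplification)

Eq. (3.1): `Pr[a = ā ∧ f = f̄] = q⁻ⁿ ρ_r(f̄)/ρ_r(Λ₂ - ā) ∈ C[1, (1+ε)/(1-ε)] ρ_r(f̄)` by Lemma 2.7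
(`r ≥ η_ε(Λ₂)`); summing over the pairs with `ā + f̄` in the class `v̄` and over a weight `g(-f̄)` is,
after the reindexing `(ā, m) ↦ ā - m ∈ Λ₁` (`tsum_ite_cl_eq_tsum`), the sum `ρ_{r, t₂ v̄}(Λ₁) · Q(g, v̄)`
with `Q` the `g`-weight of the coset Gaussian `D_{Λ₁ - t₂ v̄, r}`; Lemma 2.7 again (`r ≥ η_ε(Λ₁)`) gives
`ρ_{r,t₂ v̄}(Λ₁) ∈ [(1-ε)/(1+ε), 1] ρ_r(Λ₁)`. With `g = 1` and summing over `v̄` this pins the constant,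
whence `Pr[v = v̄, g] ≥ ((1-ε)/(1+ε))² N₂⁻¹ Q(g, v̄)` (`sq_mul_inv_card_mul_cosetSum_le`); `g = 1` is
(i) by Claim 2.1. For (ii) take `g(y) = Pr[⟨s, y⟩ + e + e' ∈ B']`: then `Q(g, v̄)` is exactly the
quantity of Regev's Cor. 3.10 for the coset `Λ₁ - t₂ v̄`, the vector `s` and the Gaussian `e + e'` of
parameter `γ = √(α² + (rB)²)`, so `|Q(g, v̄) - D_{α'}(B')| ≤ 4ε` with
`α'² = (r‖s‖)² + γ² = α² + r²(‖s‖² + B²)`. (The paper applies Lemma 2.9 to `⟨-f, s⟩ + e'` and adds `e`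
afterwards; merging the two Gaussians first only weakens the smoothing requirement and removes a
convolution step.) Summing the fibrewise lower bounds over the fibres `{i} × A_i` of a measurable `A`
gives `Pr_target[A] - Pr_joint[A] ≤ (1 - ((1-ε)/(1+ε))²) + 4ε ≤ 8ε`, and the same for `Aᶜ` gives the
other sign (both laws are probability measures). The paper's bookkeeping `4ε + 6ε = 10ε` counts the
smoothing slack twice; `8ε ≤ 10ε`.

## Conventions

`ρ_s`, `gaussianMass`, `discreteGaussian L s c` (mass `∝ ρ_s(x - c)` on `L`), `smoothingParameter` are
the tree's (`DiscreteGaussian.lean`); `D_{L+u,r}` of the sources is `u + discreteGaussian L r (-u)`;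
the one-dimensional `D_γ` is Mathlib's `gaussianReal 0 (γ²/(2π))` (the normalisation of
`LWENoise.lean`: `Ψ_γ = D_γ mod 1`); `statDist` is the tree's (`GaussianCosetSmoothing.lean`).
Hypotheses `0 < α` (so that `γ > 0`) and `‖s‖ ≤ B` are the paper's; `0 < ε ≤ 1/2` (paper: `ε < 1/2`).

## What is NOT here (next files of the decomposition)

The instantiation `M = ℤⁿ ≤ q⁻¹ℤⁿ, q'⁻¹ℤⁿ ⊆ ℝⁿ` with `ι = ℤ_qⁿ, ℤ_{q'}ⁿ`, the derivation of the two
smoothing hypotheses from the printed bound on `r` (Lemma 2.5), the packaging of the map as a Markov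
kernel on `ℤ_qⁿ × 𝕋` acting on the tree's `torusLWESample` / uniform input (including the second
coordinate of property (i)), and Theorem 3.1 / Cor. 3.2 (`m` samples, `(B, δ)`-bounded secret,
advantage loss `δ + 14εm`) — topic `Cryptography`.

## References

* Z. Brakerski, A. Langlois, C. Peikert, O. Regev, D. Stehlé, *Classical hardness of learning with
  errors*, STOC 2013, 575–584 = arXiv:1306.0281, §3: Thm. 3.1, Cor. 3.2, **Lemma 3.5 and its proof**
  (pp. 11–12), Claim 2.1, Lemmas 2.5, 2.7, 2.9 [BrakerskiEtAl2013] (held: `lit read arxiv:1306.0281`,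
  chunks p0011–p0012).
* O. Regev, *On lattices, learning with errors, random linear codes, and cryptography*, J. ACM 56
  (2009), Claim 3.8, Cor. 3.10 [RegevLWE2009].
* D. Micciancio, O. Regev, *Worst-case to average-case reductions based on Gaussian measures*, SIAM J.
  Comput. 37 (2007), Lemma 2.9 [MicciancioRegev2007].
-/

noncomputable section

open MeasureTheory ProbabilityTheory Module
open scoped Real ENNReal InnerProductSpace NNReal

namespace Literature.Algebra.EuclideanLattices

namespace BLPRS2013

variable {E : Type*} [NormedAddCommGroup E] [InnerProductSpace ℝ E] [FiniteDimensional ℝ E]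
  [MeasurableSpace E] [BorelSpace E]

/-! ### Systems of coset representatives -/

/-- `t : ι → E` together with `cl : Λ → ι` is a *system of representatives of `Λ` modulo the
subgroup `M ≤ Λ`*: every `t a` lies in `Λ`, and `cl y = a` exactly when `y ≡ t a (mod M)` (so `ι`
indexes `Λ/M`, `cl` is the class map and `t` a section). Instances: `Λ = q⁻¹ℤⁿ`, `M = ℤⁿ`, `ι = ℤ_qⁿ`,
`t a = (ā_j/q)_j`, `cl y = (q y_j mod q)_j` — BLPRS's `𝕋_qⁿ = Λ/ℤⁿ` with its distinguished
representatives. [cite: BrakerskiEtAl2013, §2.3 and Lemma 3.5] -/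
structure IsCosetReps (M Λ : Submodule ℤ E) {ι : Type*} (t : ι → E) (cl : Λ → ι) : Prop where
  le : M ≤ Λ
  mem : ∀ a, t a ∈ Λ
  cl_eq_iff : ∀ (y : Λ) (a : ι), cl y = a ↔ (y : E) - t a ∈ M

namespace IsCosetReps

variable {M Λ : Submodule ℤ E} {ι : Type*} {t : ι → E} {cl : Λ → ι}

omit [InnerProductSpace ℝ E] [FiniteDimensional ℝ E] [MeasurableSpace E] [BorelSpace E] in
/-- `y - t (cl y) ∈ M`. [folklore] -/
theorem sub_rep_mem (h : IsCosetReps M Λ t cl) (y : Λ) : (y : E) - t (cl y) ∈ M :=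
  (h.cl_eq_iff y (cl y)).1 rfl

omit [InnerProductSpace ℝ E] [FiniteDimensional ℝ E] [MeasurableSpace E] [BorelSpace E] in
/-- The bijection `ι × M ≃ Λ`, `(a, m) ↦ t a - m` (every lattice point is uniquely a representative
minus an element of `M`). [folklore] -/
def repEquiv (h : IsCosetReps M Λ t cl) : ι × M ≃ Λ where
  toFun p := ⟨t p.1 - p.2, Λ.sub_mem (h.mem p.1) (h.le p.2.2)⟩
  invFun y := (cl y, ⟨t (cl y) - y, by
    have h' := M.neg_mem (h.sub_rep_mem y)
    rwa [neg_sub] at h'⟩)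
  left_inv p := by
    rcases p with ⟨a, m⟩
    have hcl : cl ⟨t a - m, Λ.sub_mem (h.mem a) (h.le m.2)⟩ = a := by
      rw [h.cl_eq_iff]
      simp
    ext
    · exact hcl
    · simp only [hcl, sub_sub_cancel]
  right_inv y := by
    ext
    simp only [sub_sub_cancel]

omit [InnerProductSpace ℝ E] [FiniteDimensional ℝ E] [MeasurableSpace E] [BorelSpace E] in
/-- `repEquiv (a, m) = t a - m`. [folklore] -/
@[simp]
theorem coe_repEquiv (h : IsCosetReps M Λ t cl) (p : ι × M) :
    (h.repEquiv p : E) = t p.1 - p.2 := rfl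

omit [InnerProductSpace ℝ E] [FiniteDimensional ℝ E] [MeasurableSpace E] [BorelSpace E] in
/-- The class of `t a - m` is `a`. [folklore] -/
theorem cl_repEquiv (h : IsCosetReps M Λ t cl) (p : ι × M) : cl (h.repEquiv p) = p.1 := by
  have := congrArg Prod.fst (h.repEquiv.left_inv p)
  exact this

omit [InnerProductSpace ℝ E] [FiniteDimensional ℝ E] [MeasurableSpace E] [BorelSpace E] in
/-- The points of `Λ` in the class `i` are the `t i + m`, `m ∈ M`. [folklore] -/
def classEquiv [DiscreteTopology Λ] (h : IsCosetReps M Λ t cl) (i : ι) : M ≃ ({y : Λ | cl y = i} : Set Λ) :=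
  (cosetEquiv Λ M h.le (h.mem i)).trans
    (Equiv.subtypeEquivRight (q := fun y : Λ => y ∈ ({y : Λ | cl y = i} : Set Λ))
      fun y => (h.cl_eq_iff y i).symm)

omit [InnerProductSpace ℝ E] [FiniteDimensional ℝ E] [MeasurableSpace E] [BorelSpace E] in
/-- `classEquiv i m = t i + m`. [folklore] -/
@[simp]
theorem coe_classEquiv [DiscreteTopology Λ] (h : IsCosetReps M Λ t cl) (i : ι) (m : M) :
    ((h.classEquiv i m : Λ) : E) = t i + m := rfl

end IsCosetReps

/-! ### A reindexing identity: summing over representatives and over `M` is summing over `Λ₁` -/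

section Reindex

variable {M Λ₁ Λ₂ : Submodule ℤ E} [DiscreteTopology Λ₂]
variable {ι₁ ι₂ : Type*} {t₁ : ι₁ → E} {cl₁ : Λ₁ → ι₁} {t₂ : ι₂ → E} {cl₂ : Λ₂ → ι₂}

omit [InnerProductSpace ℝ E] [FiniteDimensional ℝ E] [MeasurableSpace E] [BorelSpace E] in
/-- **Reindexing.** For `F : E → ℝ≥0∞` and a class `i` of `Λ₂/M`:
`∑_{(a, x) ∈ ι₁ × Λ₂} [cl₂ x = i] F(t₁ a - x) = ∑_{y ∈ Λ₁} F(y - t₂ i)`, because the `x` of class `i`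
are the `t₂ i + m` (`m ∈ M`) and `(a, m) ↦ t₁ a - m` is a bijection `ι₁ × M ≃ Λ₁`.
[cite: BrakerskiEtAl2013, Lemma 3.5 (proof: "by summing over all `ā, f̄` satisfying `ā + f̄ = v̄`")] -/
theorem tsum_ite_cl_eq_tsum [DecidableEq ι₂] (h₁ : IsCosetReps M Λ₁ t₁ cl₁)
    (h₂ : IsCosetReps M Λ₂ t₂ cl₂) (F : E → ℝ≥0∞) (i : ι₂) :
    ∑' p : ι₁ × Λ₂, (if cl₂ p.2 = i then F (t₁ p.1 - p.2) else 0) =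
      ∑' y : Λ₁, F ((y : E) - t₂ i) := by
  classical
  rw [ENNReal.tsum_prod']
  have hinner : ∀ a : ι₁, (∑' x : Λ₂, if cl₂ x = i then F (t₁ a - x) else 0) =
      ∑' m : M, F ((t₁ a - m) - t₂ i) := by
    intro a
    have hsub : (∑' x : Λ₂, if cl₂ x = i then F (t₁ a - x) else 0) =
        ∑' x : ({y : Λ₂ | cl₂ y = i} : Set Λ₂), F (t₁ a - ((x : Λ₂) : E)) := by
      rw [tsum_subtype ({y : Λ₂ | cl₂ y = i} : Set Λ₂) (fun x : Λ₂ => F (t₁ a - x))]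
      refine tsum_congr fun x => ?_
      by_cases hx : cl₂ x = i
      · rw [if_pos hx, Set.indicator_of_mem (show x ∈ {y : Λ₂ | cl₂ y = i} from hx)]
      · rw [if_neg hx, Set.indicator_of_notMem (show x ∉ {y : Λ₂ | cl₂ y = i} from hx)]
    rw [hsub, ← (h₂.classEquiv i).tsum_eq]
    refine tsum_congr fun m => ?_
    simp only [IsCosetReps.coe_classEquiv]
    congr 1
    abel
  simp_rw [hinner]
  rw [← ENNReal.tsum_prod' (f := fun p : ι₁ × M => F ((t₁ p.1 - p.2) - t₂ i)), ← h₁.repEquiv.tsum_eq]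
  rfl

end Reindex

/-! ### The mixture of discrete Gaussians and its two-sided comparison with a single coset Gaussian -/

section Core

variable {M Λ₁ Λ₂ : Submodule ℤ E} [DiscreteTopology Λ₁] [IsZLattice ℝ Λ₁]
  [DiscreteTopology Λ₂] [IsZLattice ℝ Λ₂]
variable {ι₁ ι₂ : Type*} [Fintype ι₁] [Fintype ι₂] [DecidableEq ι₂]
variable {t₁ : ι₁ → E} {cl₁ : Λ₁ → ι₁} {t₂ : ι₂ → E} {cl₂ : Λ₂ → ι₂}

/-- The core sum of the analysis of Lemma 3.5: for a weight `g : E → [0, ∞]` on the rounding offset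
`-f = t₁ a - x` and a class `i` of `Λ₂/M`,
`S(g, i) = ∑_{a ∈ ι₁} ∑_{x ∈ Λ₂, cl₂ x = i} D_{Λ₂, r, t₁ a}(x) · g(t₁ a - x)`
(so `N₁⁻¹ S(g, i)` is the joint weight of "output class `i`" and `g`, when `a` is uniform on `ι₁` and
`x ← D_{Λ₂, r, t₁ a}`, i.e. `f = x - t₁ a ← D_{Λ₂ - t₁ a, r}`). [cite: BrakerskiEtAl2013, Lemma 3.5 (proof)] -/
def coreSum (t₁ : ι₁ → E) (cl₂ : Λ₂ → ι₂) (r : ℝ) (g : E → ℝ≥0∞) (i : ι₂) : ℝ≥0∞ :=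
  ∑' p : ι₁ × Λ₂, if cl₂ p.2 = i then discreteGaussian Λ₂ r (t₁ p.1) p.2 * g (t₁ p.1 - p.2) else 0

/-- The comparison sum: `Q(g, i) = ∑_{y ∈ Λ₁} D_{Λ₁, r, t₂ i}(y) · g(y - t₂ i)`, the `g`-weight of the
coset Gaussian `D_{Λ₁ - t₂ i, r}` (the law that `-f` is shown to be close to, conditionally on the output
class `i`). [cite: BrakerskiEtAl2013, Lemma 3.5 (proof: "the distribution of `-f` is within statistical distance `2ε` of `D_{q⁻¹ℤⁿ - v̄, r}`")] -/
def cosetSum (Λ₁ : Submodule ℤ E) [DiscreteTopology Λ₁] (t₂ : ι₂ → E) (r : ℝ) (g : E → ℝ≥0∞)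
    (i : ι₂) : ℝ≥0∞ :=
  ∑' y : Λ₁, discreteGaussian Λ₁ r (t₂ i) y * g ((y : E) - t₂ i)

omit [MeasurableSpace E] [BorelSpace E] [IsZLattice ℝ Λ₁] [Fintype ι₁] [Fintype ι₂] [DecidableEq ι₂] in
/-- `Q(1, i) = 1`. [folklore] -/
theorem cosetSum_one (r : ℝ) (i : ι₂) : cosetSum Λ₁ t₂ r (fun _ => 1) i = 1 := by
  simp only [cosetSum, mul_one]
  exact PMF.tsum_coe _

omit [MeasurableSpace E] [BorelSpace E] [IsZLattice ℝ Λ₁] [Fintype ι₁] [Fintype ι₂] [DecidableEq ι₂] in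
/-- `Q(g, i) ≤ 1` for `g ≤ 1`. [folklore] -/
theorem cosetSum_le_one (r : ℝ) {g : E → ℝ≥0∞} (hg : ∀ v, g v ≤ 1) (i : ι₂) :
    cosetSum Λ₁ t₂ r g i ≤ 1 := by
  calc cosetSum Λ₁ t₂ r g i ≤ cosetSum Λ₁ t₂ r (fun _ => 1) i :=
        ENNReal.tsum_le_tsum fun y => mul_le_mul_right (hg _) _
    _ = 1 := cosetSum_one r i

omit [MeasurableSpace E] [BorelSpace E] [IsZLattice ℝ Λ₁] [IsZLattice ℝ Λ₂] [Fintype ι₁]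
  [Fintype ι₂] in
/-- **The unnormalised sum, reindexed**:
`∑_{(a,x)} [cl₂ x = i] ρ_r(x - t₁ a) g(t₁ a - x) = ρ_{r, t₂ i}(Λ₁) · Q(g, i)`. [cite: BrakerskiEtAl2013, Lemma 3.5 (proof)] -/
theorem tsum_ite_gaussianFunction_mul_eq (h₁ : IsCosetReps M Λ₁ t₁ cl₁) (h₂ : IsCosetReps M Λ₂ t₂ cl₂)
    {r : ℝ} (hr : 0 < r) (g : E → ℝ≥0∞) (i : ι₂) :
    ∑' p : ι₁ × Λ₂, (if cl₂ p.2 = i then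
        ENNReal.ofReal (gaussianFunction r ((p.2 : E) - t₁ p.1)) * g (t₁ p.1 - p.2) else 0) =
      gaussianMass r (t₂ i) (Λ₁ : Set E) * cosetSum Λ₁ t₂ r g i := by
  have hre := tsum_ite_cl_eq_tsum h₁ h₂ (fun v => ENNReal.ofReal (gaussianFunction r v) * g v) i
  have hlhs : ∀ p : ι₁ × Λ₂, (if cl₂ p.2 = i then
      ENNReal.ofReal (gaussianFunction r ((p.2 : E) - t₁ p.1)) * g (t₁ p.1 - p.2) else 0) =
      (if cl₂ p.2 = i then
        (fun v => ENNReal.ofReal (gaussianFunction r v) * g v) (t₁ p.1 - p.2) else 0) := by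
    intro p
    simp only [← gaussianFunction_neg r (t₁ p.1 - p.2), neg_sub]
  simp_rw [hlhs]
  rw [hre, cosetSum, ← ENNReal.tsum_mul_left]
  refine tsum_congr fun y => ?_
  rw [discreteGaussian_apply Λ₁ hr, ← mul_assoc, mul_comm (gaussianMass r (t₂ i) (Λ₁ : Set E)),
    mul_assoc (ENNReal.ofReal _), ENNReal.inv_mul_cancel (gaussianMass_lattice_ne_zero Λ₁ r _)
      (gaussianMass_lattice_ne_top Λ₁ hr.ne' _), mul_one]

omit [MeasurableSpace E] [BorelSpace E] [IsZLattice ℝ Λ₁] [IsZLattice ℝ Λ₂] [Fintype ι₁] [Fintype ι₂] in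
/-- **Lower comparison**: `ρ_r(Λ₂)⁻¹ · ρ_{r,t₂ i}(Λ₁) · Q(g, i) ≤ S(g, i)` (each mixing Gaussian has
normaliser `ρ_{r, t₁ a}(Λ₂) ≤ ρ_r(Λ₂)`, MR07 Lemma 2.9). [cite: BrakerskiEtAl2013, Lemma 3.5 (proof, eq. (3.1))] -/
theorem inv_mul_mul_cosetSum_le_coreSum (h₁ : IsCosetReps M Λ₁ t₁ cl₁) (h₂ : IsCosetReps M Λ₂ t₂ cl₂)
    {r : ℝ} (hr : 0 < r) (g : E → ℝ≥0∞) (i : ι₂) :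
    (gaussianMass r 0 (Λ₂ : Set E))⁻¹ * (gaussianMass r (t₂ i) (Λ₁ : Set E) * cosetSum Λ₁ t₂ r g i) ≤
      coreSum t₁ cl₂ r g i := by
  rw [← tsum_ite_gaussianFunction_mul_eq h₁ h₂ hr g i, ← ENNReal.tsum_mul_left]
  refine ENNReal.tsum_le_tsum fun p => ?_
  by_cases hp : cl₂ p.2 = i
  · rw [if_pos hp, if_pos hp, discreteGaussian_apply Λ₂ hr]
    have hinv : (gaussianMass r 0 (Λ₂ : Set E))⁻¹ ≤ (gaussianMass r (t₁ p.1) (Λ₂ : Set E))⁻¹ :=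
      ENNReal.inv_le_inv.2 (gaussianMass_le_gaussianMass_zero_of_discrete Λ₂ hr _)
    calc (gaussianMass r 0 (Λ₂ : Set E))⁻¹ *
          (ENNReal.ofReal (gaussianFunction r ((p.2 : E) - t₁ p.1)) * g (t₁ p.1 - p.2))
        = ENNReal.ofReal (gaussianFunction r ((p.2 : E) - t₁ p.1)) *
            (gaussianMass r 0 (Λ₂ : Set E))⁻¹ * g (t₁ p.1 - p.2) := by ring
      _ ≤ ENNReal.ofReal (gaussianFunction r ((p.2 : E) - t₁ p.1)) *
            (gaussianMass r (t₁ p.1) (Λ₂ : Set E))⁻¹ * g (t₁ p.1 - p.2) := by gcongr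
  · rw [if_neg hp, if_neg hp, mul_zero]

omit [IsZLattice ℝ Λ₁] [Fintype ι₁] [Fintype ι₂] in
/-- **Upper comparison** (multiplied through by `(1-ε)/(1+ε)`):
`(1-ε)/(1+ε) · S(g, i) ≤ ρ_r(Λ₂)⁻¹ · ρ_{r,t₂ i}(Λ₁) · Q(g, i)` for `r ≥ η_ε(Λ₂)` (each normaliser
`ρ_{r, t₁ a}(Λ₂) ≥ (1-ε)/(1+ε) · ρ_r(Λ₂)`, BLPRS Lemma 2.7). [cite: BrakerskiEtAl2013, Lemma 3.5 (proof, eq. (3.1)) with Lemma 2.7] -/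
theorem ofReal_mul_coreSum_le (h₁ : IsCosetReps M Λ₁ t₁ cl₁) (h₂ : IsCosetReps M Λ₂ t₂ cl₂)
    {ε r : ℝ} (hε : 0 < ε) (hr : 0 < r) (hη₂ : smoothingParameter Λ₂ ε ≤ r) (g : E → ℝ≥0∞) (i : ι₂) :
    ENNReal.ofReal ((1 - ε) / (1 + ε)) * coreSum t₁ cl₂ r g i ≤
      (gaussianMass r 0 (Λ₂ : Set E))⁻¹ * (gaussianMass r (t₂ i) (Λ₁ : Set E) * cosetSum Λ₁ t₂ r g i) := by
  rw [← tsum_ite_gaussianFunction_mul_eq h₁ h₂ hr g i, coreSum, ← ENNReal.tsum_mul_left,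
    ← ENNReal.tsum_mul_left]
  refine ENNReal.tsum_le_tsum fun p => ?_
  by_cases hp : cl₂ p.2 = i
  · rw [if_pos hp, if_pos hp, discreteGaussian_apply Λ₂ hr]
    -- `lo · Z(c)⁻¹ ≤ Z⁻¹` from `lo · Z ≤ Z(c)`
    set lo : ℝ≥0∞ := ENNReal.ofReal ((1 - ε) / (1 + ε)) with hlo
    set Zc : ℝ≥0∞ := gaussianMass r (t₁ p.1) (Λ₂ : Set E) with hZc
    set Z : ℝ≥0∞ := gaussianMass r 0 (Λ₂ : Set E) with hZ
    have hloZ : lo * Z ≤ Zc := ofReal_mul_gaussianMass_lattice_le Λ₂ hε hr hη₂ (t₁ p.1)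
    have hc0 : Zc ≠ 0 := gaussianMass_lattice_ne_zero Λ₂ r (t₁ p.1)
    have hct : Zc ≠ ∞ := gaussianMass_lattice_ne_top Λ₂ hr.ne' (t₁ p.1)
    have hZ0 : Z ≠ 0 := gaussianMass_lattice_ne_zero Λ₂ r 0
    have hZt : Z ≠ ∞ := gaussianMass_lattice_ne_top Λ₂ hr.ne' 0
    have hkey : lo * Zc⁻¹ ≤ Z⁻¹ := by
      calc lo * Zc⁻¹ = Z⁻¹ * (lo * Z) * Zc⁻¹ := by
            rw [← mul_assoc, mul_comm Z⁻¹, mul_assoc lo, ENNReal.inv_mul_cancel hZ0 hZt, mul_one]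
        _ ≤ Z⁻¹ * Zc * Zc⁻¹ := by gcongr
        _ = Z⁻¹ := by rw [mul_assoc, ENNReal.mul_inv_cancel hc0 hct, mul_one]
    calc lo * (ENNReal.ofReal (gaussianFunction r ((p.2 : E) - t₁ p.1)) * Zc⁻¹ * g (t₁ p.1 - p.2))
        = ENNReal.ofReal (gaussianFunction r ((p.2 : E) - t₁ p.1)) * (lo * Zc⁻¹) * g (t₁ p.1 - p.2) := by
          ring
      _ ≤ ENNReal.ofReal (gaussianFunction r ((p.2 : E) - t₁ p.1)) * Z⁻¹ * g (t₁ p.1 - p.2) := by gcongr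
      _ = Z⁻¹ * (ENNReal.ofReal (gaussianFunction r ((p.2 : E) - t₁ p.1)) * g (t₁ p.1 - p.2)) := by ring
  · rw [if_neg hp, if_neg hp, mul_zero, mul_zero]

omit [MeasurableSpace E] [BorelSpace E] [DiscreteTopology Λ₁] [IsZLattice ℝ Λ₁] [IsZLattice ℝ Λ₂] in
/-- **Normalisation**: `∑_i S(1, i) = N₁` (each of the `N₁` mixing Gaussians has mass one).
[folklore] -/
theorem sum_coreSum_one (r : ℝ) :
    ∑ i, coreSum t₁ cl₂ r (fun _ => 1) i = (Fintype.card ι₁ : ℝ≥0∞) := by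
  simp only [coreSum, mul_one]
  rw [← tsum_fintype (L := SummationFilter.unconditional _), ENNReal.tsum_comm]
  have hin : ∀ p : ι₁ × Λ₂, (∑' i : ι₂, if cl₂ p.2 = i then discreteGaussian Λ₂ r (t₁ p.1) p.2 else 0) =
      discreteGaussian Λ₂ r (t₁ p.1) p.2 := fun p => by
    rw [tsum_fintype (L := SummationFilter.unconditional _), Finset.sum_ite_eq]
    simp
  simp_rw [hin]
  rw [ENNReal.tsum_prod', tsum_fintype (L := SummationFilter.unconditional _)]
  simp only [PMF.tsum_coe, Finset.sum_const, Finset.card_univ, nsmul_eq_mul, mul_one]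

/-- **The key lower bound** (the two smoothing steps of the proof of Lemma 3.5 combined): for
`r ≥ η_ε(Λ₁)` and `r ≥ η_ε(Λ₂)`, every class `i` and every weight `g`,
`((1-ε)/(1+ε))² · N₂⁻¹ · Q(g, i) ≤ N₁⁻¹ · S(g, i)`:
the mixture puts on (class `i`, weight `g`) at least `((1-ε)/(1+ε))²` times what "uniform class, offset
`← D_{Λ₁ - t₂ i, r}`" puts. [cite: BrakerskiEtAl2013, Lemma 3.5 (proof)] -/
theorem sq_mul_inv_card_mul_cosetSum_le (h₁ : IsCosetReps M Λ₁ t₁ cl₁) (h₂ : IsCosetReps M Λ₂ t₂ cl₂)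
    {ε r : ℝ} (hε : 0 < ε) (hr : 0 < r) (hη₁ : smoothingParameter Λ₁ ε ≤ r)
    (hη₂ : smoothingParameter Λ₂ ε ≤ r) (g : E → ℝ≥0∞) (i : ι₂) :
    ENNReal.ofReal ((1 - ε) / (1 + ε)) ^ 2 * (Fintype.card ι₂ : ℝ≥0∞)⁻¹ * cosetSum Λ₁ t₂ r g i ≤
      (Fintype.card ι₁ : ℝ≥0∞)⁻¹ * coreSum t₁ cl₂ r g i := by
  haveI : Nonempty ι₁ := ⟨cl₁ 0⟩
  haveI : Nonempty ι₂ := ⟨cl₂ 0⟩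
  set lo : ℝ≥0∞ := ENNReal.ofReal ((1 - ε) / (1 + ε)) with hlo
  set N₁ : ℝ≥0∞ := (Fintype.card ι₁ : ℝ≥0∞) with hN₁
  set N₂ : ℝ≥0∞ := (Fintype.card ι₂ : ℝ≥0∞) with hN₂
  set Z₁ : ℝ≥0∞ := gaussianMass r 0 (Λ₁ : Set E) with hZ₁
  set Z₂ : ℝ≥0∞ := gaussianMass r 0 (Λ₂ : Set E) with hZ₂
  set K : ℝ≥0∞ := Z₂⁻¹ * Z₁ with hK
  have hN₁0 : N₁ ≠ 0 := by rw [hN₁]; exact_mod_cast Fintype.card_ne_zero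
  have hN₁t : N₁ ≠ ∞ := ENNReal.natCast_ne_top _
  have hN₂0 : N₂ ≠ 0 := by rw [hN₂]; exact_mod_cast Fintype.card_ne_zero
  have hN₂t : N₂ ≠ ∞ := ENNReal.natCast_ne_top _
  -- centred masses of `Λ₁` against `Z₁`
  have hZ₁lo : ∀ c : E, lo * Z₁ ≤ gaussianMass r c (Λ₁ : Set E) := fun c =>
    ofReal_mul_gaussianMass_lattice_le Λ₁ hε hr hη₁ c
  have hZ₁up : ∀ c : E, gaussianMass r c (Λ₁ : Set E) ≤ Z₁ := fun c =>
    gaussianMass_le_gaussianMass_zero_of_discrete Λ₁ hr c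
  -- (U): `lo · S(1, j) ≤ K` for every class `j`
  have hU : ∀ j : ι₂, lo * coreSum t₁ cl₂ r (fun _ => 1) j ≤ K := by
    intro j
    calc lo * coreSum t₁ cl₂ r (fun _ => 1) j
        ≤ Z₂⁻¹ * (gaussianMass r (t₂ j) (Λ₁ : Set E) * cosetSum Λ₁ t₂ r (fun _ => 1) j) :=
          ofReal_mul_coreSum_le h₁ h₂ hε hr hη₂ _ j
      _ ≤ Z₂⁻¹ * (Z₁ * 1) := by
          rw [cosetSum_one]
          have := hZ₁up (t₂ j)
          gcongr
      _ = K := by rw [mul_one]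
  -- summing (U) over the classes: `lo · N₁ ≤ N₂ · K`
  have hsum : lo * N₁ ≤ N₂ * K := by
    calc lo * N₁ = ∑ j, lo * coreSum t₁ cl₂ r (fun _ => 1) j := by
          rw [← Finset.mul_sum, sum_coreSum_one]
      _ ≤ ∑ _j : ι₂, K := Finset.sum_le_sum fun j _ => hU j
      _ = N₂ * K := by rw [Finset.sum_const, Finset.card_univ, nsmul_eq_mul]
  have hK' : lo * N₁ * N₂⁻¹ ≤ K := by
    calc lo * N₁ * N₂⁻¹ ≤ N₂ * K * N₂⁻¹ := by gcongr
      _ = K := by rw [mul_comm N₂, mul_assoc, ENNReal.mul_inv_cancel hN₂0 hN₂t, mul_one]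
  -- (L): `K · lo · Q(g, i) ≤ S(g, i)`
  have hL : K * (lo * cosetSum Λ₁ t₂ r g i) ≤ coreSum t₁ cl₂ r g i := by
    calc K * (lo * cosetSum Λ₁ t₂ r g i) = Z₂⁻¹ * (lo * Z₁ * cosetSum Λ₁ t₂ r g i) := by
          rw [hK]; ring
      _ ≤ Z₂⁻¹ * (gaussianMass r (t₂ i) (Λ₁ : Set E) * cosetSum Λ₁ t₂ r g i) := by
          have := hZ₁lo (t₂ i)
          gcongr
      _ ≤ coreSum t₁ cl₂ r g i := inv_mul_mul_cosetSum_le_coreSum h₁ h₂ hr g i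
  -- combine
  calc lo ^ 2 * N₂⁻¹ * cosetSum Λ₁ t₂ r g i
      = N₁⁻¹ * ((lo * N₁ * N₂⁻¹) * (lo * cosetSum Λ₁ t₂ r g i)) := by
        rw [sq]
        calc lo * lo * N₂⁻¹ * cosetSum Λ₁ t₂ r g i
            = (N₁⁻¹ * N₁) * (lo * lo * N₂⁻¹ * cosetSum Λ₁ t₂ r g i) := by
              rw [ENNReal.inv_mul_cancel hN₁0 hN₁t, one_mul]
          _ = N₁⁻¹ * ((lo * N₁ * N₂⁻¹) * (lo * cosetSum Λ₁ t₂ r g i)) := by ring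
    _ ≤ N₁⁻¹ * (K * (lo * cosetSum Λ₁ t₂ r g i)) := by gcongr
    _ ≤ N₁⁻¹ * coreSum t₁ cl₂ r g i := by gcongr

end Core

/-! ### Two elementary real-number facts -/

omit [NormedAddCommGroup E] [InnerProductSpace ℝ E] [FiniteDimensional ℝ E] [MeasurableSpace E]
  [BorelSpace E] in
/-- `1 - ((1-ε)/(1+ε))² ≤ 4ε` for `0 ≤ ε ≤ 1/2` (BLPRS: "`1 - ((1-ε)/(1+ε))² ≤ 4ε`"). [cite: BrakerskiEtAl2013, Lemma 3.5 (proof)] -/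
theorem one_sub_sq_ratio_le {ε : ℝ} (hε : 0 ≤ ε) (hε' : ε ≤ 1 / 2) :
    1 - ((1 - ε) / (1 + ε)) ^ 2 ≤ 4 * ε := by
  have h1 : 0 < 1 + ε := by linarith
  have hlo : 1 - 2 * ε ≤ (1 - ε) / (1 + ε) := by
    rw [le_div_iff₀ h1]; nlinarith
  have h0 : 0 ≤ 1 - 2 * ε := by linarith
  nlinarith [mul_le_mul hlo hlo h0 (h0.trans hlo)]

omit [NormedAddCommGroup E] [InnerProductSpace ℝ E] [FiniteDimensional ℝ E] [MeasurableSpace E]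
  [BorelSpace E] in
/-- `0 ≤ (1-ε)/(1+ε) ≤ 1` for `0 ≤ ε ≤ 1`. [folklore] -/
theorem ratio_nonneg_and_le_one {ε : ℝ} (hε : 0 ≤ ε) (hε1 : ε ≤ 1) :
    0 ≤ (1 - ε) / (1 + ε) ∧ (1 - ε) / (1 + ε) ≤ 1 :=
  ⟨div_nonneg (by linarith) (by linarith), (div_le_one (by linarith)).2 (by linarith)⟩

omit [NormedAddCommGroup E] [InnerProductSpace ℝ E] [FiniteDimensional ℝ E] [MeasurableSpace E]
  [BorelSpace E] in
/-- **BLPRS Claim 2.1 on a finite set, in the form used here**: masses `p_i` summing to `1` with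
`p_i ≥ (1-δ)/N` for all `i` are within statistical distance `δ` of uniform:
`|∑_{i ∈ S} p_i - |S|/N| ≤ δ` for every `S`. [cite: BrakerskiEtAl2013, Claim 2.1] -/
theorem abs_sum_sub_card_div_le {ι : Type*} [Fintype ι] {p : ι → ℝ} {δ : ℝ}
    (hsum : ∑ i, p i = 1) (hlow : ∀ i, (1 - δ) / Fintype.card ι ≤ p i) (S : Finset ι) :
    |∑ i ∈ S, p i - S.card / Fintype.card ι| ≤ δ := by
  classical
  set N : ℝ := (Fintype.card ι : ℝ) with hN
  have hNpos : 0 < N := by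
    rcases isEmpty_or_nonempty ι with h | h
    · simp [Finset.univ_eq_empty] at hsum
    · rw [hN]; exact_mod_cast Fintype.card_pos
  -- `δ ≥ 0` from the total mass
  have hδ : 0 ≤ δ := by
    have : ∑ _i : ι, (1 - δ) / N ≤ ∑ i, p i := Finset.sum_le_sum fun i _ => hlow i
    rw [hsum, Finset.sum_const, Finset.card_univ, nsmul_eq_mul, ← hN] at this
    have h' : N * ((1 - δ) / N) = 1 - δ := by field_simp
    linarith
  have hS : ∑ _i ∈ S, (1 - δ) / N ≤ ∑ i ∈ S, p i := Finset.sum_le_sum fun i _ => hlow i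
  have hSc : ∑ _i ∈ Sᶜ, (1 - δ) / N ≤ ∑ i ∈ Sᶜ, p i := Finset.sum_le_sum fun i _ => hlow i
  rw [Finset.sum_const, nsmul_eq_mul] at hS hSc
  have hcompl : ∑ i ∈ Sᶜ, p i = 1 - ∑ i ∈ S, p i := by
    rw [← hsum, ← Finset.sum_add_sum_compl S]; ring
  rw [Finset.card_compl, Nat.cast_sub (Finset.card_le_univ S), ← hN] at hSc
  have hcard : (S.card : ℝ) ≤ N := by rw [hN]; exact_mod_cast Finset.card_le_univ S
  have hcard0 : (0 : ℝ) ≤ S.card := Nat.cast_nonneg _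
  rw [abs_le]
  constructor
  · -- lower: `∑_S p ≥ |S|(1-δ)/N ≥ |S|/N - δ`
    have : (S.card : ℝ) * ((1 - δ) / N) = S.card / N - δ * (S.card / N) := by field_simp
    have h2 : δ * (S.card / N) ≤ δ := by
      have : S.card / N ≤ 1 := (div_le_one hNpos).2 hcard
      nlinarith
    linarith
  · -- upper: via the complement
    have : ((N - S.card : ℝ)) * ((1 - δ) / N) = 1 - S.card / N - δ * ((N - S.card) / N) := by
      field_simp
    have h2 : δ * ((N - S.card) / N) ≤ δ := by
      have : (N - S.card) / N ≤ 1 := (div_le_one hNpos).2 (by linarith)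
      nlinarith
    linarith

/-! ### Lemma 3.5 (i): the first output component is `4ε`-uniform -/

section FirstComponent

variable {M Λ₁ Λ₂ : Submodule ℤ E} [DiscreteTopology Λ₁] [IsZLattice ℝ Λ₁]
  [DiscreteTopology Λ₂] [IsZLattice ℝ Λ₂]
variable {ι₁ ι₂ : Type*} [Fintype ι₁] [Fintype ι₂] [DecidableEq ι₂] [Nonempty ι₁]
variable {t₁ : ι₁ → E} {cl₁ : Λ₁ → ι₁} {t₂ : ι₂ → E} {cl₂ : Λ₂ → ι₂}

/-- The law of the FIRST output component of the reduction of Lemma 3.5 (`G = I`) on a uniformly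
random input `a ∈ Λ₁/M` (= `𝕋_qⁿ`): `v = ā + f mod M` with `f ← D_{Λ₂ - ā, r}`, i.e. `v` is the class of
`x ← D_{Λ₂, r, t₁ a}` in `Λ₂/M` (= `𝕋_{q'}ⁿ`). [cite: BrakerskiEtAl2013, Lemma 3.5 (the map, first bullet)] -/
def fstLaw (t₁ : ι₁ → E) (cl₂ : Λ₂ → ι₂) (r : ℝ) : PMF ι₂ :=
  (PMF.uniformOfFintype ι₁).bind fun a => (discreteGaussian Λ₂ r (t₁ a)).map cl₂

omit [MeasurableSpace E] [BorelSpace E] [DiscreteTopology Λ₁] [IsZLattice ℝ Λ₁] [IsZLattice ℝ Λ₂]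
  [Fintype ι₂] in
/-- `Pr[v = i] = N₁⁻¹ · S(1, i)`. [folklore] -/
theorem fstLaw_apply (r : ℝ) (i : ι₂) :
    fstLaw t₁ cl₂ r i = (Fintype.card ι₁ : ℝ≥0∞)⁻¹ * coreSum t₁ cl₂ r (fun _ => 1) i := by
  rw [fstLaw, PMF.bind_apply, coreSum, ENNReal.tsum_prod', ← ENNReal.tsum_mul_left]
  refine tsum_congr fun a => ?_
  rw [PMF.uniformOfFintype_apply, PMF.map_apply]
  congr 1
  refine tsum_congr fun x => ?_
  by_cases hx : cl₂ x = i
  · rw [if_pos hx, if_pos hx.symm, mul_one]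
  · rw [if_neg hx, if_neg fun h => hx h.symm]

/-- **Pointwise form of Lemma 3.5 (i)**: for `r ≥ η_ε(Λ₁)`, `r ≥ η_ε(Λ₂)`, every class has probability
at least `((1-ε)/(1+ε))² / N₂` ("`Pr[v = v̄] ∈ [(1-ε)/(1+ε), (1+ε)/(1-ε)] · C'`").
[cite: BrakerskiEtAl2013, Lemma 3.5 (proof)] -/
theorem sq_mul_inv_card_le_fstLaw (h₁ : IsCosetReps M Λ₁ t₁ cl₁) (h₂ : IsCosetReps M Λ₂ t₂ cl₂)
    {ε r : ℝ} (hε : 0 < ε) (hr : 0 < r) (hη₁ : smoothingParameter Λ₁ ε ≤ r)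
    (hη₂ : smoothingParameter Λ₂ ε ≤ r) (i : ι₂) :
    ENNReal.ofReal ((1 - ε) / (1 + ε)) ^ 2 * (Fintype.card ι₂ : ℝ≥0∞)⁻¹ ≤ fstLaw t₁ cl₂ r i := by
  have h := sq_mul_inv_card_mul_cosetSum_le h₁ h₂ hε hr hη₁ hη₂ (fun _ => 1) i
  rwa [cosetSum_one, mul_one, ← fstLaw_apply] at h

/-- **BLPRS 2013, Lemma 3.5, first property (`G = I`), discrete core.** If `r ≥ η_ε(Λ₁)` and
`r ≥ η_ε(Λ₂)` (`0 < ε ≤ 1/2`), the first output component `v` on a uniform input is within statistical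
distance `1 - ((1-ε)/(1+ε))² ≤ 4ε` of uniform on `Λ₂/M`: for every set `S` of classes,
`|Pr[v ∈ S] - |S|/N₂| ≤ 4ε`. (The full first property — the output PAIR on a uniform input pair is
`4ε`-uniform — follows because `b' = b + e'` with `b` uniform on `𝕋` and independent of `v`.)
[cite: BrakerskiEtAl2013, Lemma 3.5 (first property)] -/
theorem abs_sum_fstLaw_toReal_sub_le (h₁ : IsCosetReps M Λ₁ t₁ cl₁) (h₂ : IsCosetReps M Λ₂ t₂ cl₂)
    {ε r : ℝ} (hε : 0 < ε) (hε' : ε ≤ 1 / 2) (hr : 0 < r) (hη₁ : smoothingParameter Λ₁ ε ≤ r)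
    (hη₂ : smoothingParameter Λ₂ ε ≤ r) (S : Finset ι₂) :
    |∑ i ∈ S, (fstLaw t₁ cl₂ r i).toReal - S.card / Fintype.card ι₂| ≤ 4 * ε := by
  set lo : ℝ := (1 - ε) / (1 + ε) with hlo
  have hlo0 : 0 ≤ lo := (ratio_nonneg_and_le_one hε.le (by linarith)).1
  refine (abs_sum_sub_card_div_le (δ := 1 - lo ^ 2) ?_ ?_ S).trans (one_sub_sq_ratio_le hε.le hε')
  · rw [← ENNReal.toReal_sum fun i _ => PMF.apply_ne_top _ _,
      ← tsum_fintype (L := SummationFilter.unconditional _), PMF.tsum_coe, ENNReal.toReal_one]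
  · intro i
    have h := ENNReal.toReal_mono (PMF.apply_ne_top _ _)
      (sq_mul_inv_card_le_fstLaw h₁ h₂ hε hr hη₁ hη₂ i)
    rw [ENNReal.toReal_mul, ← ENNReal.ofReal_pow hlo0, ENNReal.toReal_ofReal (pow_nonneg hlo0 _),
      ENNReal.toReal_inv, ENNReal.toReal_natCast] at h
    rw [sub_sub_cancel, div_eq_mul_inv]
    exact h

end FirstComponent

/-! ### Lemma 3.5 (ii): the output on an `LWE` sample -/

section Joint

variable {M Λ₁ Λ₂ : Submodule ℤ E} [DiscreteTopology Λ₁] [IsZLattice ℝ Λ₁]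
  [DiscreteTopology Λ₂] [IsZLattice ℝ Λ₂]
variable {ι₁ ι₂ : Type*} [Fintype ι₁] [Fintype ι₂] [DecidableEq ι₂] [Nonempty ι₁] [Nonempty ι₂]
  [MeasurableSpace ι₂] [MeasurableSingletonClass ι₂]
variable {t₁ : ι₁ → E} {cl₁ : Λ₁ → ι₁} {t₂ : ι₂ → E} {cl₂ : Λ₂ → ι₂}

/-- The one-dimensional Gaussian `D_γ` of the sources, `γ² = α² + (rB)²`: Mathlib's
`gaussianReal 0 (γ²/(2π))` (density `∝ exp(-π x²/γ²)`, the normalisation of `LWENoise.lean`). This is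
the law of `e + e'`, `e ← D_α` the noise of the input sample and `e' ← D_{rB}` the noise added by the
reduction. [cite: BrakerskiEtAl2013, §2.2 and Lemma 3.5 (the map, second bullet)] -/
def noiseLaw (r α B : ℝ) : Measure ℝ :=
  gaussianReal 0 (Real.toNNReal ((α ^ 2 + (r * B) ^ 2) / (2 * π)))

/-- `D_γ` is a probability measure. [folklore] -/
instance isProbabilityMeasure_noiseLaw (r α B : ℝ) : IsProbabilityMeasure (noiseLaw r α B) := by
  unfold noiseLaw; infer_instance

/-- The joint law, on `(Λ₂/M) × ℝ`, of the output class `v` and of the real number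
`w = e + ⟨-f, s⟩ + e'` produced by the reduction of Lemma 3.5 (`G = I`) from an input sample
`(a, b = ⟨ā, s⟩ + e)` of `A_{q,s,D_α}` (`a` uniform): `a ← U(ι₁)`, `x ← D_{Λ₂, r, t₁ a}` (so
`-f = t₁ a - x`), `e + e' ← D_{√(α² + (rB)²)}`; the output pair is `(v, b') = (v, ⟨v, s⟩ + w mod 1)`
(using `⟨ā, s⟩ = ⟨x, s⟩ + ⟨-f, s⟩` and `⟨x, s⟩ ≡ ⟨t₂ v, s⟩ (mod 1)` when `⟨M, s⟩ ⊆ ℤ`), a fixed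
measurable function of `(v, w)`. [cite: BrakerskiEtAl2013, Lemma 3.5 (proof: "`b' = ⟨a', Gs⟩ + e + ⟨-f, s⟩ + e' mod 1`")] -/
def jointLaw (t₁ : ι₁ → E) (cl₂ : Λ₂ → ι₂) (r α B : ℝ) (s : E) : Measure (ι₂ × ℝ) :=
  Measure.sum fun p : ι₁ × Λ₂ =>
    ((Fintype.card ι₁ : ℝ≥0∞)⁻¹ * discreteGaussian Λ₂ r (t₁ p.1) p.2) •
      (noiseLaw r α B).map fun e : ℝ => (cl₂ p.2, ⟪s, t₁ p.1 - p.2⟫_ℝ + e)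

variable (ι₂) in
/-- The target law: `v` uniform on `Λ₂/M` and, independently, `w ← D_{α'}` with
`α'² = α² + r²(‖s‖² + B²)` — under the same fixed function of `(v, w)` this is `A_{q', s, D_{α'}}`.
[cite: BrakerskiEtAl2013, Lemma 3.5 (second property)] -/
def targetLaw (r α B : ℝ) (s : E) : Measure (ι₂ × ℝ) :=
  (PMF.uniformOfFintype ι₂).toMeasure.prod
    (gaussianReal 0 (Real.toNNReal ((α ^ 2 + r ^ 2 * (‖s‖ ^ 2 + B ^ 2)) / (2 * π))))

/-- The target law is a probability measure. [folklore] -/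
instance isProbabilityMeasure_targetLaw (r α B : ℝ) (s : E) :
    IsProbabilityMeasure (targetLaw ι₂ r α B s) := by
  unfold targetLaw; infer_instance

omit [MeasurableSpace E] [BorelSpace E] [DiscreteTopology Λ₁] [IsZLattice ℝ Λ₁] [IsZLattice ℝ Λ₂] [Fintype ι₂]
  [Nonempty ι₁] [Nonempty ι₂] in
/-- The joint law of a rectangle `{i} × B'`: `N₁⁻¹ · S(g_{B'}, i)` with the weight
`g_{B'}(y) = Pr_{e ← D_γ}[⟨s, y⟩ + e ∈ B']`. [folklore] -/
theorem jointLaw_singleton_prod (r α B : ℝ) (s : E) (i : ι₂) {B' : Set ℝ}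
    (hB' : MeasurableSet B') :
    jointLaw t₁ cl₂ r α B s ({i} ×ˢ B') =
      (Fintype.card ι₁ : ℝ≥0∞)⁻¹ *
        coreSum t₁ cl₂ r (fun y => noiseLaw r α B ((fun e : ℝ => ⟪s, y⟫_ℝ + e) ⁻¹' B')) i := by
  rw [jointLaw, Measure.sum_apply _ ((measurableSet_singleton i).prod hB'), coreSum,
    ← ENNReal.tsum_mul_left]
  refine tsum_congr fun p => ?_
  rw [Measure.smul_apply, smul_eq_mul,
    Measure.map_apply (by fun_prop) ((measurableSet_singleton i).prod hB')]
  by_cases hp : cl₂ p.2 = i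
  · rw [if_pos hp]
    have hpre : (fun e : ℝ => (cl₂ p.2, ⟪s, t₁ p.1 - p.2⟫_ℝ + e)) ⁻¹' ({i} ×ˢ B') =
        (fun e : ℝ => ⟪s, t₁ p.1 - (p.2 : E)⟫_ℝ + e) ⁻¹' B' := by
      ext e
      simp [hp]
    rw [hpre, mul_assoc]
  · rw [if_neg hp]
    have hpre : (fun e : ℝ => (cl₂ p.2, ⟪s, t₁ p.1 - p.2⟫_ℝ + e)) ⁻¹' ({i} ×ˢ B') = ∅ := by
      ext e
      simp [hp]
    rw [hpre, measure_empty, mul_zero, mul_zero]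

omit [MeasurableSpace E] [BorelSpace E] [DiscreteTopology Λ₁] [IsZLattice ℝ Λ₁] [IsZLattice ℝ Λ₂] [Fintype ι₂]
  [DecidableEq ι₂] [Nonempty ι₂] [MeasurableSingletonClass ι₂] in
/-- The joint law is a probability measure. [folklore] -/
theorem jointLaw_univ (r α B : ℝ) (s : E) : jointLaw t₁ cl₂ r α B s Set.univ = 1 := by
  rw [jointLaw, Measure.sum_apply _ MeasurableSet.univ]
  have hterm : ∀ p : ι₁ × Λ₂, (((Fintype.card ι₁ : ℝ≥0∞)⁻¹ * discreteGaussian Λ₂ r (t₁ p.1) p.2) •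
      (noiseLaw r α B).map (fun e : ℝ => (cl₂ p.2, ⟪s, t₁ p.1 - p.2⟫_ℝ + e))) Set.univ =
      (Fintype.card ι₁ : ℝ≥0∞)⁻¹ * discreteGaussian Λ₂ r (t₁ p.1) p.2 := by
    intro p
    rw [Measure.smul_apply, smul_eq_mul, Measure.map_apply (by fun_prop) MeasurableSet.univ,
      Set.preimage_univ, measure_univ, mul_one]
  simp_rw [hterm]
  rw [ENNReal.tsum_mul_left, ENNReal.tsum_prod', tsum_fintype (L := SummationFilter.unconditional _)]
  simp only [PMF.tsum_coe, Finset.sum_const, Finset.card_univ, nsmul_eq_mul, mul_one]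
  exact ENNReal.inv_mul_cancel (by exact_mod_cast Fintype.card_ne_zero) (ENNReal.natCast_ne_top _)

/-- The joint law is a probability measure. [folklore] -/
instance isProbabilityMeasure_jointLaw (r α B : ℝ) (s : E) :
    IsProbabilityMeasure (jointLaw t₁ cl₂ r α B s) :=
  ⟨jointLaw_univ r α B s⟩

omit [MeasurableSpace E] [BorelSpace E] [DiscreteTopology Λ₁] [IsZLattice ℝ Λ₁] [IsZLattice ℝ Λ₂] [Fintype ι₂]
  [Nonempty ι₂] in
/-- Consistency of (i) and (ii): the first marginal of the joint law is `fstLaw` (the law of `v` does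
not depend on `s`, `α`, `B`). [folklore] -/
theorem jointLaw_singleton_prod_univ (r α B : ℝ) (s : E) (i : ι₂) :
    jointLaw t₁ cl₂ r α B s ({i} ×ˢ Set.univ) = fstLaw t₁ cl₂ r i := by
  rw [jointLaw_singleton_prod r α B s i MeasurableSet.univ, fstLaw_apply]
  simp only [Set.preimage_univ, measure_univ]

omit [NormedAddCommGroup E] [InnerProductSpace ℝ E] [FiniteDimensional ℝ E] [MeasurableSpace E]
  [BorelSpace E] [DecidableEq ι₂] [Nonempty ι₂] in
/-- A measure on `ι₂ × β` (`ι₂` finite, singletons measurable) is the sum of its restrictions to the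
fibres: `μ(A) = ∑_i μ({i} × A_i)`, `A_i = {w | (i, w) ∈ A}`. [folklore] -/
theorem measure_eq_sum_singleton_prod {β : Type*} [MeasurableSpace β] (μ : Measure (ι₂ × β))
    {A : Set (ι₂ × β)} (hA : MeasurableSet A) :
    μ A = ∑ i, μ ({i} ×ˢ (Prod.mk i ⁻¹' A)) := by
  have hdecomp : A = ⋃ i, ({i} ×ˢ (Prod.mk i ⁻¹' A)) := by
    ext ⟨j, w⟩
    simp
  conv_lhs => rw [hdecomp]
  rw [measure_iUnion, tsum_fintype (L := SummationFilter.unconditional _)]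
  · intro i j hij
    exact Set.disjoint_prod.2 (Or.inl (Set.disjoint_singleton.2 hij))
  · exact fun i => (measurableSet_singleton i).prod (measurable_prodMk_left hA)

omit [MeasurableSpace E] [BorelSpace E] [InnerProductSpace ℝ E] [FiniteDimensional ℝ E]
  [DecidableEq ι₂] in
/-- The target law of a rectangle `{i} × B'`: `N₂⁻¹ · D_{α'}(B')`. [folklore] -/
theorem targetLaw_singleton_prod (r α B : ℝ) (s : E) (i : ι₂) (B' : Set ℝ) :
    targetLaw ι₂ r α B s ({i} ×ˢ B') = (Fintype.card ι₂ : ℝ≥0∞)⁻¹ *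
      gaussianReal 0 (Real.toNNReal ((α ^ 2 + r ^ 2 * (‖s‖ ^ 2 + B ^ 2)) / (2 * π))) B' := by
  rw [targetLaw, Measure.prod_prod, PMF.toMeasure_apply_singleton _ _ (measurableSet_singleton i),
    PMF.uniformOfFintype_apply]

omit [MeasurableSpace E] [BorelSpace E] [IsZLattice ℝ Λ₁] [DiscreteTopology Λ₂] [IsZLattice ℝ Λ₂]
  [Fintype ι₁] [Fintype ι₂] [DecidableEq ι₂] [Nonempty ι₁] [Nonempty ι₂] [MeasurableSpace ι₂]
  [MeasurableSingletonClass ι₂] in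
/-- The comparison sum with the weight `g_{B'}`, as the real series of Regev's Cor. 3.10.
[folklore] -/
theorem cosetSum_noise_toReal (r α B : ℝ) (s : E) (i : ι₂) (B' : Set ℝ) :
    (cosetSum Λ₁ t₂ r (fun y => noiseLaw r α B ((fun e : ℝ => ⟪s, y⟫_ℝ + e) ⁻¹' B')) i).toReal =
      ∑' y : Λ₁, (discreteGaussian Λ₁ r (t₂ i) y).toReal *
        (noiseLaw r α B).real ((fun e : ℝ => ⟪s, (y : E) - t₂ i⟫_ℝ + e) ⁻¹' B') := by
  rw [cosetSum, ENNReal.tsum_toReal_eq fun y =>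
    ENNReal.mul_ne_top (PMF.apply_ne_top _ _) (measure_ne_top _ _)]
  refine tsum_congr fun y => ?_
  rw [ENNReal.toReal_mul, measureReal_def]

omit [IsZLattice ℝ Λ₂] [DiscreteTopology Λ₂] [Fintype ι₁] [Fintype ι₂] [DecidableEq ι₂] [Nonempty ι₁]
  [Nonempty ι₂] [MeasurableSpace ι₂] [MeasurableSingletonClass ι₂] in
/-- **The noise step** (Regev 2009 Cor. 3.10 = BLPRS Lemma 2.9, applied once with the combined
Gaussian `e + e'`): if `η_ε(Λ₁) ≤ r/√2`, `‖s‖ ≤ B`, `0 < α`, then for `y ← D_{Λ₁ - t₂ i, r}` and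
`e + e' ← D_γ`, `γ² = α² + (rB)²`, the real number `⟨s, y⟩ + e + e'` is `4ε`-close to `D_{α'}`,
`α'² = (r‖s‖)² + γ² = α² + r²(‖s‖² + B²)`: the hypothesis of Cor. 3.10,
`η_ε(Λ₁) ≤ 1/√(1/r² + (‖s‖/γ)²)`, holds because `‖s‖/γ ≤ B/(rB) = 1/r`. (BLPRS apply Lemma 2.9 to
`⟨-f, s⟩ + e'` and then add `e`; doing both at once only weakens the smoothing requirement.)
[cite: BrakerskiEtAl2013, Lemma 3.5 (proof, last paragraph) with Lemma 2.9] -/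
theorem abs_cosetSum_noise_toReal_sub_le {ε r α B : ℝ} {s : E} (hε : 0 < ε) (hε' : ε ≤ 1 / 2)
    (hr : 0 < r) (hα : 0 < α) (hsB : ‖s‖ ≤ B)
    (hη₁ : smoothingParameter Λ₁ ε ≤ r / Real.sqrt 2) (i : ι₂) {B' : Set ℝ}
    (hB' : MeasurableSet B') :
    |(cosetSum Λ₁ t₂ r (fun y => noiseLaw r α B ((fun e : ℝ => ⟪s, y⟫_ℝ + e) ⁻¹' B')) i).toReal -
        (gaussianReal 0 (Real.toNNReal ((α ^ 2 + r ^ 2 * (‖s‖ ^ 2 + B ^ 2)) / (2 * π)))).real B'| ≤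
      4 * ε := by
  set γ : ℝ := Real.sqrt (α ^ 2 + (r * B) ^ 2) with hγ
  have hγpos : 0 < γ := Real.sqrt_pos.2 (by positivity)
  have hγsq : γ ^ 2 = α ^ 2 + (r * B) ^ 2 := Real.sq_sqrt (by positivity)
  have hB0 : 0 ≤ B := (norm_nonneg s).trans hsB
  -- the smoothing hypothesis of Cor. 3.10
  have hkey : r / Real.sqrt 2 ≤ 1 / Real.sqrt (1 / r ^ 2 + (‖s‖ / γ) ^ 2) := by
    have hq : (‖s‖ / γ) ^ 2 ≤ 1 / r ^ 2 := by
      rw [div_pow, div_le_div_iff₀ (by positivity) (by positivity), one_mul, hγsq]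
      have h1 : ‖s‖ ^ 2 * r ^ 2 ≤ B ^ 2 * r ^ 2 :=
        mul_le_mul_of_nonneg_right (pow_le_pow_left₀ (norm_nonneg s) hsB 2) (sq_nonneg r)
      nlinarith [sq_nonneg α]
    have hpos : 0 < Real.sqrt (1 / r ^ 2 + (‖s‖ / γ) ^ 2) := Real.sqrt_pos.2 (by positivity)
    have hle : Real.sqrt (1 / r ^ 2 + (‖s‖ / γ) ^ 2) ≤ Real.sqrt 2 / r := by
      have h2 : (Real.sqrt 2 / r) ^ 2 = 2 / r ^ 2 := by
        rw [div_pow, Real.sq_sqrt (by norm_num : (0 : ℝ) ≤ 2)]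
      rw [Real.sqrt_le_left (by positivity), h2]
      calc 1 / r ^ 2 + (‖s‖ / γ) ^ 2 ≤ 1 / r ^ 2 + 1 / r ^ 2 := by linarith
        _ = 2 / r ^ 2 := by ring
    calc r / Real.sqrt 2 = 1 / (Real.sqrt 2 / r) := by
          field_simp
      _ ≤ 1 / Real.sqrt (1 / r ^ 2 + (‖s‖ / γ) ^ 2) :=
          one_div_le_one_div_of_le hpos hle
  have h := Regev2009.corollary_3_10 Λ₁ (-t₂ i) s hε hε' hr hγpos (hη₁.trans hkey) hB'
  simp only [neg_neg, ← sub_eq_add_neg] at h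
  rw [cosetSum_noise_toReal]
  have hvar : (‖s‖ ^ 2 * r ^ 2 + γ ^ 2) / (2 * π) = (α ^ 2 + r ^ 2 * (‖s‖ ^ 2 + B ^ 2)) / (2 * π) := by
    rw [hγsq]; ring
  rw [noiseLaw, ← hγsq, ← hvar]
  exact h

/-- **The key lower bound on rectangles**: for `r ≥ √2 η_ε(Λ₁)`, `r ≥ η_ε(Λ₂)`, `‖s‖ ≤ B`, `0 < α`,
`Pr[(v, w) ∈ {i} × B'] ≥ ((1-ε)/(1+ε))²/N₂ · (D_{α'}(B') - 4ε)`. [cite: BrakerskiEtAl2013, Lemma 3.5 (proof)] -/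
theorem sq_div_card_mul_sub_le_jointLaw_toReal (h₁ : IsCosetReps M Λ₁ t₁ cl₁)
    (h₂ : IsCosetReps M Λ₂ t₂ cl₂) {ε r α B : ℝ} {s : E} (hε : 0 < ε) (hε' : ε ≤ 1 / 2) (hr : 0 < r)
    (hα : 0 < α) (hsB : ‖s‖ ≤ B) (hη₁ : smoothingParameter Λ₁ ε ≤ r / Real.sqrt 2)
    (hη₂ : smoothingParameter Λ₂ ε ≤ r) (i : ι₂) {B' : Set ℝ} (hB' : MeasurableSet B') :
    ((1 - ε) / (1 + ε)) ^ 2 / Fintype.card ι₂ *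
        ((gaussianReal 0 (Real.toNNReal ((α ^ 2 + r ^ 2 * (‖s‖ ^ 2 + B ^ 2)) / (2 * π)))).real B' -
          4 * ε) ≤
      (jointLaw t₁ cl₂ r α B s ({i} ×ˢ B')).toReal := by
  set lo : ℝ := (1 - ε) / (1 + ε) with hlo
  have hlo0 : 0 ≤ lo := (ratio_nonneg_and_le_one hε.le (by linarith)).1
  have hη₁' : smoothingParameter Λ₁ ε ≤ r := by
    refine hη₁.trans (div_le_self hr.le ?_)
    have := Real.sqrt_le_sqrt (show (1 : ℝ) ≤ 2 by norm_num)
    rwa [Real.sqrt_one] at this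
  set g : E → ℝ≥0∞ := fun y => noiseLaw r α B ((fun e : ℝ => ⟪s, y⟫_ℝ + e) ⁻¹' B') with hg
  -- the `ℝ≥0∞` bound, moved to `ℝ`
  have hJ := sq_mul_inv_card_mul_cosetSum_le h₁ h₂ hε hr hη₁' hη₂ g i
  rw [← jointLaw_singleton_prod r α B s i hB'] at hJ
  have hJ' := ENNReal.toReal_mono (measure_ne_top _ _) hJ
  rw [ENNReal.toReal_mul, ENNReal.toReal_mul, ← ENNReal.ofReal_pow hlo0,
    ENNReal.toReal_ofReal (pow_nonneg hlo0 _), ENNReal.toReal_inv, ENNReal.toReal_natCast] at hJ'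
  -- the noise step
  have hQ := (abs_le.1 (abs_cosetSum_noise_toReal_sub_le (Λ₁ := Λ₁) (t₂ := t₂) hε hε' hr hα hsB hη₁
    i hB')).1
  calc lo ^ 2 / Fintype.card ι₂ *
        ((gaussianReal 0 (Real.toNNReal ((α ^ 2 + r ^ 2 * (‖s‖ ^ 2 + B ^ 2)) / (2 * π)))).real B' -
          4 * ε)
      ≤ lo ^ 2 / Fintype.card ι₂ * (cosetSum Λ₁ t₂ r g i).toReal := by
        apply mul_le_mul_of_nonneg_left _ (by positivity)
        rw [hg]; linarith
    _ = lo ^ 2 * (Fintype.card ι₂ : ℝ)⁻¹ * (cosetSum Λ₁ t₂ r g i).toReal := by rw [div_eq_mul_inv]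
    _ ≤ (jointLaw t₁ cl₂ r α B s ({i} ×ˢ B')).toReal := hJ'

/-- One-sided form of the main estimate: `Pr_target[A] - Pr_joint[A] ≤ 8ε`. [cite: BrakerskiEtAl2013, Lemma 3.5 (proof)] -/
theorem targetLaw_real_sub_jointLaw_real_le (h₁ : IsCosetReps M Λ₁ t₁ cl₁)
    (h₂ : IsCosetReps M Λ₂ t₂ cl₂) {ε r α B : ℝ} {s : E} (hε : 0 < ε) (hε' : ε ≤ 1 / 2) (hr : 0 < r)
    (hα : 0 < α) (hsB : ‖s‖ ≤ B) (hη₁ : smoothingParameter Λ₁ ε ≤ r / Real.sqrt 2)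
    (hη₂ : smoothingParameter Λ₂ ε ≤ r) {A : Set (ι₂ × ℝ)} (hA : MeasurableSet A) :
    (targetLaw ι₂ r α B s).real A - (jointLaw t₁ cl₂ r α B s).real A ≤ 8 * ε := by
  set lo : ℝ := (1 - ε) / (1 + ε) with hlo
  have hlo01 := ratio_nonneg_and_le_one hε.le (by linarith : ε ≤ 1)
  have hlo2 : lo ^ 2 ≤ 1 := pow_le_one₀ hlo01.1 hlo01.2
  have h4 : 1 - lo ^ 2 ≤ 4 * ε := one_sub_sq_ratio_le hε.le hε'
  set N : ℝ := (Fintype.card ι₂ : ℝ) with hN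
  have hNpos : 0 < N := by rw [hN]; exact_mod_cast Fintype.card_pos
  set G : Measure ℝ :=
    gaussianReal 0 (Real.toNNReal ((α ^ 2 + r ^ 2 * (‖s‖ ^ 2 + B ^ 2)) / (2 * π))) with hG
  -- fibre decomposition of both measures
  have hJ : (jointLaw t₁ cl₂ r α B s).real A =
      ∑ i, (jointLaw t₁ cl₂ r α B s ({i} ×ˢ (Prod.mk i ⁻¹' A))).toReal := by
    rw [measureReal_def, measure_eq_sum_singleton_prod _ hA,
      ENNReal.toReal_sum fun i _ => measure_ne_top _ _]
  have hT : (targetLaw ι₂ r α B s).real A = ∑ i, G.real (Prod.mk i ⁻¹' A) / N := by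
    rw [measureReal_def, measure_eq_sum_singleton_prod _ hA,
      ENNReal.toReal_sum fun i _ => measure_ne_top _ _]
    refine Finset.sum_congr rfl fun i _ => ?_
    rw [targetLaw_singleton_prod r α B s i (Prod.mk i ⁻¹' A), ENNReal.toReal_mul,
      ENNReal.toReal_inv, ENNReal.toReal_natCast, ← measureReal_def, hG, hN, mul_comm]
    exact (div_eq_mul_inv _ _).symm
  rw [hJ, hT, ← Finset.sum_sub_distrib]
  -- per fibre: `G(A_i)/N - J({i} × A_i) ≤ ((1 - lo²) G(A_i) + 4ε lo²)/N ≤ 8ε/N`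
  have hfib : ∀ i, G.real (Prod.mk i ⁻¹' A) / N -
      (jointLaw t₁ cl₂ r α B s ({i} ×ˢ (Prod.mk i ⁻¹' A))).toReal ≤ 8 * ε / N := by
    intro i
    have hlow := sq_div_card_mul_sub_le_jointLaw_toReal h₁ h₂ hε hε' hr hα hsB hη₁ hη₂ i
      (B' := Prod.mk i ⁻¹' A) (measurable_prodMk_left hA)
    rw [← hN, ← hG] at hlow
    have hG1 : G.real (Prod.mk i ⁻¹' A) ≤ 1 := measureReal_le_one
    have hG0 : 0 ≤ G.real (Prod.mk i ⁻¹' A) := measureReal_nonneg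
    have : G.real (Prod.mk i ⁻¹' A) / N - lo ^ 2 / N * (G.real (Prod.mk i ⁻¹' A) - 4 * ε) ≤
        8 * ε / N := by
      rw [div_mul_eq_mul_div, ← sub_div, div_le_div_iff_of_pos_right hNpos]
      nlinarith
    linarith
  calc ∑ i, (G.real (Prod.mk i ⁻¹' A) / N -
        (jointLaw t₁ cl₂ r α B s ({i} ×ˢ (Prod.mk i ⁻¹' A))).toReal)
      ≤ ∑ _i : ι₂, 8 * ε / N := Finset.sum_le_sum fun i _ => hfib i
    _ = 8 * ε := by
        rw [Finset.sum_const, Finset.card_univ, nsmul_eq_mul, ← hN]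
        field_simp

/-- **BLPRS 2013, Lemma 3.5, second property (`G = I`), lattice form, sharpened constant.** Under
`0 < ε ≤ 1/2`, `0 < r`, `0 < α`, `‖s‖ ≤ B`, `η_ε(Λ₁) ≤ r/√2` and `η_ε(Λ₂) ≤ r` (for `Λ₁ = q⁻¹ℤⁿ`,
`Λ₂ = q'⁻¹ℤⁿ` these follow from the printed `r ≥ max(q⁻¹, q'⁻¹) · √(2 ln(2n(1+1/ε))/π)` by Lemma 2.5),
the joint law of (output class `v`, noise `w = e + ⟨-f, s⟩ + e'`) is within statistical distance `8ε`
(the paper's accounting gives `4ε + 6ε = 10ε`) of (uniform class) ⊗ `D_{α'}`,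
`α'² = α² + r²(‖s‖² + B²)`: for every measurable `A`, `|Pr_joint[A] - Pr_target[A]| ≤ 8ε`.
[cite: BrakerskiEtAl2013, Lemma 3.5 (second property)] -/
theorem abs_jointLaw_real_sub_targetLaw_real_le (h₁ : IsCosetReps M Λ₁ t₁ cl₁)
    (h₂ : IsCosetReps M Λ₂ t₂ cl₂) {ε r α B : ℝ} {s : E} (hε : 0 < ε) (hε' : ε ≤ 1 / 2) (hr : 0 < r)
    (hα : 0 < α) (hsB : ‖s‖ ≤ B) (hη₁ : smoothingParameter Λ₁ ε ≤ r / Real.sqrt 2)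
    (hη₂ : smoothingParameter Λ₂ ε ≤ r) {A : Set (ι₂ × ℝ)} (hA : MeasurableSet A) :
    |(jointLaw t₁ cl₂ r α B s).real A - (targetLaw ι₂ r α B s).real A| ≤ 8 * ε := by
  rw [abs_sub_comm, abs_le]
  constructor
  · have h := targetLaw_real_sub_jointLaw_real_le h₁ h₂ hε hε' hr hα hsB hη₁ hη₂ hA.compl
    rw [probReal_compl_eq_one_sub hA, probReal_compl_eq_one_sub hA] at h
    linarith
  · exact targetLaw_real_sub_jointLaw_real_le h₁ h₂ hε hε' hr hα hsB hη₁ hη₂ hA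

/-- **BLPRS 2013, Lemma 3.5, second property, as printed** ("within statistical distance `10ε`"), with
the tree's `statDist`. [cite: BrakerskiEtAl2013, Lemma 3.5 (second property)] -/
theorem statDist_jointLaw_targetLaw_le (h₁ : IsCosetReps M Λ₁ t₁ cl₁)
    (h₂ : IsCosetReps M Λ₂ t₂ cl₂) {ε r α B : ℝ} {s : E} (hε : 0 < ε) (hε' : ε ≤ 1 / 2) (hr : 0 < r)
    (hα : 0 < α) (hsB : ‖s‖ ≤ B) (hη₁ : smoothingParameter Λ₁ ε ≤ r / Real.sqrt 2)
    (hη₂ : smoothingParameter Λ₂ ε ≤ r) :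
    statDist (jointLaw t₁ cl₂ r α B s) (targetLaw ι₂ r α B s) ≤ 10 * ε :=
  statDist_le_of_forall_abs_sub_le (by positivity) fun A hA =>
    (abs_jointLaw_real_sub_targetLaw_real_le h₁ h₂ hε hε' hr hα hsB hη₁ hη₂ hA).trans (by linarith)

end Joint

end BLPRS2013

end Literature.Algebra.EuclideanLattices

end
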